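import Summits.MatrixMultiplication.OmegaCensus.SmallFormats.GF2OrbitChecks
import Literature.Computability.AlgebraicComplexity.ConstrainedMatMulTranspose
import HarnessLib

/-!
# ω-census family (a): transposed sandwich lookups for square first factors (CHECKER step + soundness)

Cell `pub-mm22` (MatrixMultiplication venture, Route D3-STRETCH `⟨3,3,3⟩/𝔽₂`), topic
`Summits/MatrixMultiplication/OmegaCensus` (sub-folder `SmallFormats`, next to `GF2OrbitChecks.lean`).
HAND-OVER SNIPPET written by seat LIT-2 g3 for the p3 successor / bench interim (LIT-2 does not propose
Summits files).  Wang's `⟨3,3,3⟩` orbit table (496 orbits, Table 9 "transpose? yes") is reduced by the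
transpose symmetry `X ↦ Xᵀ` (§4.1), so a replayed certificate needs lookups whose witness is
`x ↦ P xᵀ Q`; this file is `sandB`/`le_of_sandB` (GF2OrbitChecks.lean) with the transpose inserted,
discharged by `BilinComp.ofTransposeSandwichLE` (Literature, ConstrainedMatMulTranspose.lean, p321688).

* `trBits l m x` — bits of `(ofBits l m x)ᵀ`; `ofBits_trBits`.
* `sandTB l Kr Kt P Pi Q Qi` — `P' P = 1 ∧ Q Q' = 1 ∧ ∀ x ∈ S_{Kr}, P xᵀ Q ∈ S_{Kt}` (all `x < 2^{l l}`).
* `le_of_sandTB` — a lower bound for all computations on `S_{Kr}` is one for all computations on `S_{Kt}`.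

HONEST FRAMING: checker plumbing for a kernel replay of published numbers; no new bound, not progress on `ω`.
-/

namespace Summit.MatrixMultiplication.OmegaCensus.GF2RankLB

open Module Matrix Literature.Computability.AlgebraicComplexity

/-- Bits of the transpose: the `m × l` matrix `(ofBits l m x)ᵀ`. -/
def trBits (l m : ℕ) (x : ℕ) : ℕ := maskOf (fun p => x.testBit (pos m (p % l) (p / l))) (m * l)

/-- `trBits` encodes the transpose. -/
theorem ofBits_trBits (l m x : ℕ) : ofBits m l (trBits l m x) = (ofBits l m x)ᵀ := by
  ext j i
  simp only [ofBits_apply, trBits, testBit_maskOf, Matrix.transpose_apply]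
  have hp : pos l j i < m * l := by
    have := (finProdFinEquiv (j, i)).2
    rwa [← pos_eq] at this
  have hl : 0 < l := Nat.pos_of_ne_zero fun h => by subst h; exact absurd i.2 (by simp)
  have hdiv : pos l j i / l = j := by
    simp only [pos]; rw [Nat.add_mul_div_left _ _ hl, Nat.div_eq_of_lt i.2, zero_add]
  have hmod : pos l j i % l = i := by
    simp only [pos]; rw [Nat.add_mul_mod_self_left, Nat.mod_eq_of_lt i.2]
  simp only [hp, decide_true, Bool.true_and, hdiv, hmod]

/-- Transposed sandwich check (square first factor `l = m`): `P' P = 1`, `Q Q' = 1`, and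
`P xᵀ Q ∈ S_{Kt}` for every `x ∈ S_{Kr}` (all `x` enumerated). -/
def sandTB (l : ℕ) (Kr Kt : List ℕ) (P Pi Q Qi : ℕ) : Bool :=
  (mulBits l l l Pi P == oneBits l) && (mulBits l l l Q Qi == oneBits l) &&
    allLT (fun x => !memB (l * l) Kr x ||
      memB (l * l) Kt (mulBits l l l (mulBits l l l P (trBits l l x)) Q)) (2 ^ (l * l))

/-- Soundness of `sandTB` (Wang 2026, Lemma 1 with the transpose symmetry of §4.1, explicit
witness): a lower bound for all computations on `S_{Kr}` is a lower bound for all computations on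
`S_{Kt}` whenever `P (S_{Kr})ᵀ Q ⊆ S_{Kt}`. -/
theorem le_of_sandTB {l n : ℕ} {Kr Kt : List ℕ} {P Pi Q Qi : ℕ} (h : sandTB l Kr Kt P Pi Q Qi = true)
    {b : ℕ} (hb : ∀ r, BilinComp (psiK l l n Kr) (Fin r) → b ≤ r) (r : ℕ)
    (β : BilinComp (psiK l l n Kt) (Fin r)) : b ≤ r := by
  simp only [sandTB, Bool.and_eq_true, beq_iff_eq] at h
  obtain ⟨⟨hP, hQ⟩, hmap⟩ := h
  rw [allLT_iff] at hmap
  refine hb r (β.ofTransposeSandwichLE (ofBits l l P) (ofBits l l Pi) (ofBits l l Q) (ofBits l l Qi)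
    (ofBits_eq_one_of_mulBits_eq hP) (ofBits_eq_one_of_mulBits_eq hQ) ?_)
  rw [forall_matrix_iff]
  intro x hx hmem
  have h1 := hmap x hx
  rw [ofBits_mem_subOf_iff] at hmem
  simp only [hmem, Bool.not_true, Bool.false_or] at h1
  rw [← ofBits_trBits, ← ofBits_mulBits, ← ofBits_mulBits, ofBits_mem_subOf_iff]
  exact h1

end Summit.MatrixMultiplication.OmegaCensus.GF2RankLB
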